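import Mathlib.RepresentationTheory.Homological.GroupCohomology.Functoriality
import Mathlib.GroupTheory.GroupExtension.Defs
import HarnessLib

/-!
# The group extension defined by a 2-cocycle, and splitting of inflated extensions

Topic `Algebra/Homology`; namespace `Literature.Algebra.Homology`.  One definition with a body
(`CocycleExtension`, with its `Group`, `Finite` instances and the `GroupExtension` structure) and
theorems; Mathlib-only imports; no named fact, no `sorry`.

For a group `G`, a commutative ring `k`, a representation `A : Rep k G` and an inhomogeneous
2-cocycle `f ∈ Z²(G, A)` (Mathlib `groupCohomology.cocycles₂ A`:
`f (g h, j) + f (g, h) = g • f (h, j) + f (g, h j)`), the classical **crossed-product / twisted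
product** group `E_f` on the set `A × G`,
`(a, g) · (b, h) = (a + g • b + f (g, h), g h)`,
is a group (associativity IS the cocycle identity; the unit is `(-f (1, 1), 1)` because `f` need not
be normalised), and `a ↦ (a - f (1, 1), 1)`, `(a, g) ↦ g` make it an extension
`1 → A → E_f → G → 1` of `G` by the `G`-module `A` whose class is `[f] ∈ H²(G, A)`: the set-theoretic
section `g ↦ (0, g)` has `(0, g)(0, h) = ι(f (g, h)) · (0, g h)` (`mk_zero_mul_mk_zero`).  This is the
construction behind "`H²(G, A)` classifies extensions of `G` by `A`" (Brown, *Cohomology of Groups*,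
IV §3, Theorem 3.12; Serre, *Cohomologie galoisienne*, I §2.3), which Mathlib does not have yet
(`Mathlib/GroupTheory/GroupExtension/` has the structure `GroupExtension` and the split case only).

The one theorem proved about it here is the half of that classification needed for lifting /
embedding problems (Serre, *Cohomologie galoisienne*, I §3.4: "the lifting property for
`1 → P → E → W → 1` and `f : G → W` is equivalent to the splitting of the pull-back extension
`E_f → G`"): **if a homomorphism `φ : H → G` lifts to `E_f`, i.e. there is a homomorphism
`s : H → E_f` with `pr ∘ s = φ`, then the inflated class `φ^*[f] ∈ H²(H, φ^*A)` vanishes**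
(`map_H2π_eq_zero_of_comp_eq`): writing `s h = (c h, φ h)`, multiplicativity of `s` says exactly
`φ^*f = -∂c`, a 2-coboundary.  Used in `FiniteEmbeddingProblemCohomology.lean` (Serre's criterion
"solving all finite embedding problems ⟹ `cd(Ĝ) ≤ 1`", finite level).

## References

* K. S. Brown, *Cohomology of Groups*, GTM 87, Springer (1982), IV §3 (extensions with abelian
  kernel; (3.3)–(3.5): the group law `(a, g)(b, h) = (a + g b + f(g, h), g h)` on `A × G` from a
  factor set; Theorem 3.12: `H²(G, A) ≅ ℰ(G, A)`).  [Brown1982CohomologyGroups]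
* J-P. Serre, *Cohomologie galoisienne*, LNM 5, 5e éd. (1994) = *Galois Cohomology* (1997), I §2.3
  (interpretation of `H²` by extensions) and I §3.4 (lifting property ⟺ splitting of the pull-back).
  [Serre1997]

## Not here

The converse (a splitting of `φ^*E_f` from `φ^*[f] = 0`), the bijection `H²(G, A) ≃ ℰ(G, A)`
itself, equivalence of the extensions attached to cohomologous cocycles, non-abelian kernels.
-/

noncomputable section

namespace Literature.Algebra.Homology

open CategoryTheory groupCohomology

universe u

variable {k G : Type u} [CommRing k] [Group G] {A : Rep k G}

/-- The **extension group `E_f` of `G` by the `G`-module `A` defined by a 2-cocycle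
`f ∈ Z²(G, A)`**: as a set `A × G` (fields `left`, `right`), with multiplication
`(a, g) · (b, h) = (a + g • b + f (g, h), g h)` (Brown, *Cohomology of Groups*, IV §3, (3.3)–(3.5);
`f` is not assumed normalised, so the unit is `(-f (1, 1), 1)`).
[cite: Brown1982CohomologyGroups, IV §3 (3.3)–(3.5) and Thm 3.12] -/
@[ext]
structure CocycleExtension (f : cocycles₂ A) : Type u where
  /-- the coordinate in the kernel `A` -/
  left : A
  /-- the coordinate in the quotient `G` -/
  right : G

namespace CocycleExtension

variable (f : cocycles₂ A)

/-- Multiplication on `E_f`: `(a, g) · (b, h) = (a + g • b + f (g, h), g h)`.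
[cite: Brown1982CohomologyGroups, IV §3 (3.3)–(3.5)] -/
instance : Mul (CocycleExtension f) :=
  ⟨fun x y => ⟨x.left + A.ρ x.right y.left + f (x.right, y.right), x.right * y.right⟩⟩

/-- The unit of `E_f`: `(-f (1, 1), 1)` (`f` is not assumed normalised). [folklore] -/
instance : One (CocycleExtension f) := ⟨⟨-f (1, 1), 1⟩⟩

/-- Inversion on `E_f`: `(a, g)⁻¹ = (-f (1, 1) - g⁻¹ • a - f (g⁻¹, g), g⁻¹)`. [folklore] -/
instance : Inv (CocycleExtension f) :=
  ⟨fun x => ⟨-f (1, 1) - A.ρ x.right⁻¹ x.left - f (x.right⁻¹, x.right), x.right⁻¹⟩⟩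

variable {f}

/-- First coordinate of a product in `E_f`: `a + g • b + f (g, h)`. [folklore] -/
@[simp] theorem mul_left (x y : CocycleExtension f) :
    (x * y).left = x.left + A.ρ x.right y.left + f (x.right, y.right) := rfl

/-- Second coordinate of a product in `E_f`: `g h`. [folklore] -/
@[simp] theorem mul_right (x y : CocycleExtension f) : (x * y).right = x.right * y.right := rfl

/-- First coordinate of the unit of `E_f`: `-f (1, 1)`. [folklore] -/
@[simp] theorem one_left : (1 : CocycleExtension f).left = -f (1, 1) := rfl

/-- Second coordinate of the unit of `E_f`: `1`. [folklore] -/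
@[simp] theorem one_right : (1 : CocycleExtension f).right = 1 := rfl

/-- First coordinate of an inverse in `E_f`. [folklore] -/
@[simp] theorem inv_left (x : CocycleExtension f) :
    x⁻¹.left = -f (1, 1) - A.ρ x.right⁻¹ x.left - f (x.right⁻¹, x.right) := rfl

/-- Second coordinate of an inverse in `E_f`: `g⁻¹`. [folklore] -/
@[simp] theorem inv_right (x : CocycleExtension f) : x⁻¹.right = x.right⁻¹ := rfl

variable (f) in
/-- `E_f` is a group: associativity is the 2-cocycle identity
`f (g h, j) + f (g, h) = g • f (h, j) + f (g, h j)`, the unit laws are `f (1, g) = f (1, 1)` and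
`f (g, 1) = g • f (1, 1)` (Mathlib `cocycles₂_map_one_fst/snd`).
[cite: Brown1982CohomologyGroups, IV §3 (3.3)–(3.5)] -/
instance instGroup : Group (CocycleExtension f) where
  mul_assoc x y z := by
    ext
    · have hc := (mem_cocycles₂_iff (A := A) f).1 f.2 x.right y.right z.right
      have hc' : f (x.right * y.right, z.right) =
          A.ρ x.right (f (y.right, z.right)) + f (x.right, y.right * z.right) - f (x.right, y.right) :=
        eq_sub_of_add_eq hc
      simp only [mul_left, mul_right, map_add, map_mul, Module.End.mul_apply, hc']
      abel
    · simp only [mul_right, mul_assoc]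
  one_mul x := by
    ext
    · simp only [mul_left, one_left, one_right, map_one, Module.End.one_apply,
        cocycles₂_map_one_fst f x.right]
      abel
    · simp only [mul_right, one_right, one_mul]
  mul_one x := by
    ext
    · simp only [mul_left, one_left, one_right, map_neg, cocycles₂_map_one_snd f x.right]
      abel
    · simp only [mul_right, one_right, mul_one]
  inv_mul_cancel x := by
    ext
    · simp only [mul_left, inv_left, inv_right, one_left]
      abel
    · simp only [mul_right, inv_right, inv_mul_cancel, one_right]

/-- `E_f` is in bijection with `A × G`. [folklore] -/
def equivProd (f : cocycles₂ A) : CocycleExtension f ≃ A × G where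
  toFun x := (x.left, x.right)
  invFun p := ⟨p.1, p.2⟩
  left_inv _ := rfl
  right_inv _ := rfl

/-- `E_f` is finite when `A` and `G` are. [folklore] -/
instance instFinite [Finite A] [Finite G] : Finite (CocycleExtension f) :=
  Finite.of_equiv _ (equivProd f).symm

variable (f)

/-- The projection `E_f → G`, `(a, g) ↦ g`. [cite: Brown1982CohomologyGroups, IV §3] -/
def rightHom : CocycleExtension f →* G where
  toFun := right
  map_one' := rfl
  map_mul' _ _ := rfl

/-- `rightHom (a, g) = g`. [folklore] -/
@[simp] theorem rightHom_apply (x : CocycleExtension f) : rightHom f x = x.right := rfl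

/-- The projection `E_f → G` is surjective (`g ↦ (0, g)` is a set-theoretic section). [folklore] -/
theorem rightHom_surjective : Function.Surjective (rightHom f) := fun g => ⟨⟨0, g⟩, rfl⟩

/-- The kernel embedding `A → E_f`, `a ↦ (a - f (1, 1), 1)` (the shift by `f (1, 1)` because `f` is
not normalised), as a homomorphism from `Multiplicative A`. [cite: Brown1982CohomologyGroups, IV §3] -/
def inl : Multiplicative A →* CocycleExtension f where
  toFun a := ⟨a.toAdd - f (1, 1), 1⟩
  map_one' := by
    ext
    · simp
    · rfl
  map_mul' a b := by
    ext
    · simp only [toAdd_mul, mul_left, map_one, Module.End.one_apply]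
      abel
    · simp

/-- `inl a = (a - f (1, 1), 1)`, first coordinate. [folklore] -/
@[simp] theorem inl_left (a : Multiplicative A) : (inl f a).left = a.toAdd - f (1, 1) := rfl

/-- `inl a = (a - f (1, 1), 1)`, second coordinate. [folklore] -/
@[simp] theorem inl_right (a : Multiplicative A) : (inl f a).right = 1 := rfl

/-- The kernel embedding is injective. [folklore] -/
theorem inl_injective : Function.Injective (inl f) := by
  intro a b h
  have h1 := congrArg left h
  simp only [inl_left, sub_left_inj] at h1
  exact Multiplicative.toAdd.injective h1

/-- Exactness in the middle: the image of `A` is the kernel of `E_f → G`. [folklore] -/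
theorem range_inl_eq_ker_rightHom : (inl f).range = (rightHom f).ker := by
  ext x
  constructor
  · rintro ⟨a, rfl⟩
    simp [MonoidHom.mem_ker]
  · intro hx
    rw [MonoidHom.mem_ker, rightHom_apply] at hx
    refine ⟨Multiplicative.ofAdd (x.left + f (1, 1)), ?_⟩
    ext
    · simp
    · simp [hx]

/-- **`1 → A → E_f → G → 1` is a group extension** (Mathlib `GroupExtension`).
[cite: Brown1982CohomologyGroups, IV §3 (3.3)–(3.5)] -/
def toGroupExtension : GroupExtension (Multiplicative A) (CocycleExtension f) G where
  inl := inl f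
  rightHom := rightHom f
  inl_injective := inl_injective f
  range_inl_eq_ker_rightHom := range_inl_eq_ker_rightHom f
  rightHom_surjective := rightHom_surjective f

/-- The factor set of `E_f` with respect to the set-theoretic section `g ↦ (0, g)` is `f`:
`(0, g) · (0, h) = ι(f (g, h)) · (0, g h)`.  So the class of the extension `E_f` in `H²(G, A)` is
`[f]` (Brown IV (3.3)). [cite: Brown1982CohomologyGroups, IV §3 (3.3) and Thm 3.12] -/
theorem mk_zero_mul_mk_zero (g h : G) :
    (⟨0, g⟩ * ⟨0, h⟩ : CocycleExtension f) =
      inl f (Multiplicative.ofAdd (f (g, h))) * ⟨0, g * h⟩ := by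
  ext
  · simp only [mul_left, map_zero, add_zero, zero_add, inl_left, toAdd_ofAdd, inl_right, map_one,
      cocycles₂_map_one_fst f (g * h)]
    abel
  · simp

/-- Conjugation in `E_f` induces the given `G`-action on `A`: `x · ι(a) · x⁻¹ = ι(g • a)` for `x`
over `g`. [cite: Brown1982CohomologyGroups, IV §3 (3.1)] -/
theorem mul_inl_mul_inv (x : CocycleExtension f) (a : A) :
    x * inl f (Multiplicative.ofAdd a) * x⁻¹ = inl f (Multiplicative.ofAdd (A.ρ x.right a)) := by
  have h1 : A.ρ x.right (A.ρ x.right⁻¹ x.left) = x.left := by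
    rw [← Module.End.mul_apply, ← map_mul, mul_inv_cancel, map_one, Module.End.one_apply]
  have h2 := cocycles₂_ρ_map_inv_sub_map_inv f x.right
  have h3 := cocycles₂_map_one_snd f x.right
  ext
  · simp only [mul_left, mul_right, inl_left, toAdd_ofAdd, inl_right, inv_left, inv_right, mul_one,
      map_sub, map_neg, h1, h3]
    rw [sub_eq_iff_eq_add.1 (h2.trans (by rw [h3]))]
    abel
  · simp

/-! ### Splitting over `φ` kills the inflated class -/

/-- **A lift of `φ : H → G` to `E_f` makes `φ^*[f] = 0` in `H²(H, φ^*A)`.**  If `s : H →* E_f`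
satisfies `pr ∘ s = φ`, write `s h = (c h, φ h)`; multiplicativity of `s` reads
`c (h₁ h₂) = c h₁ + φ(h₁) • c h₂ + f (φ h₁, φ h₂)`, i.e. `φ^*f = ∂(-c)` is a 2-coboundary, so the
inflation `φ^* : H²(G, A) → H²(H, φ^*A)` (Mathlib `groupCohomology.map φ (𝟙 _) 2`) kills `[f]`.
Equivalently: the pull-back extension `φ^*E_f → H` splits (Serre, *Cohomologie galoisienne*, I §3.4,
first paragraph; Brown IV §3: split extensions have trivial class).
[cite: Serre1997, I §3.4 (lifting property ⟺ splitting of the pull-back) with I §2.3] -/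
theorem map_H2π_eq_zero_of_comp_eq {H : Type u} [Group H] (φ : H →* G)
    (s : H →* CocycleExtension f) (hs : (rightHom f).comp s = φ) :
    map φ (𝟙 (Rep.res φ A)) 2 (H2π A f) = 0 := by
  have hright : ∀ h, (s h).right = φ h := fun h => by rw [← hs]; rfl
  rw [H2π_comp_map_apply, H2π_eq_zero_iff]
  refine ⟨fun h => -(s h).left, ?_⟩
  funext p
  obtain ⟨h₁, h₂⟩ := p
  have hmul := congrArg left (s.map_mul h₁ h₂)
  simp only [mul_left, hright] at hmul
  simp only [d₁₂_hom_apply, MonoidHom.coe_comp, Function.comp_apply, map_neg]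
  rw [hmul]
  change _ = f (φ h₁, φ h₂)
  abel

end CocycleExtension

end Literature.Algebra.Homology

end
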